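import Summits.QuantumFields.YangMills.Theorems.UnitScaleTiltProp7DivRecoveryOfCollected
import HarnessLib

/-!
# Prop. 7 on T³ — lane II (B7-KNIT) v2: (REC) VERBATIM from the collected row WITH A PATCH-EXPONENT FLOOR `s₀`

Route `UnitScaleTilt`, crux `MinimiserStabilityRegPr` (stmt-QuantumFields-19200), E′ growth side, lane II «divergence recovery at the curved regular member».
(E1) of the PATCHES2 assembler (ym3-torus-px12 g9): ✓`Prop7DivRecoveryOfCollected.hRec_of_collected` consumes its collected row `hColl` at ONE exponent `s`
with `A₃·L^{−2s} ≤ δ` — any larger `s` serves equally.  This sibling takes `hColl` WITH A FLOOR (`… 0 ≤ A₃ ∧ ∃ s₀ : ℕ, ∀ s : ℕ, s₀ ≤ s → …`, = the conclusion of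
`Prop7DivRecoveryCollectedOfRowsV2.hColl_of_rows_v2`) and proves the SAME row (REC) — the hypothesis `hRec` of ✓`Prop7HcoOfDivRecovery.hN06_of_divRecovery` VERBATIM —
by choosing `s := max s₀ s₁`; everything else is ✓`hRec_of_collected`'s proof (Pythagoras ✓`norm_sq_eq_proj_add_orth`, ✓`almostPos_DeltaEtaSlot_of_regPr`,
✓`rec_shape_of_collected`, ✓`hRec_of_large`).  The landed file is untouched; the lane-II door is unchanged.

HONEST SCOPE.  Bookkeeping; `hColl` (v2) is OPEN; nothing of (REC)∕hN06∕hcoS∕E′∕EX∕the crux is proved here; YM₃ on T³ is rung R3 — NOT d = 4, NOT infinite volume,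
NOT a mass gap, NOT Clay.
[cite: Balaban1985BackgroundPropagators, (3.10) p.392, (3.20)-(3.26) pp.394-395, Thm 3.11 p.416]
-/

set_option autoImplicit false

noncomputable section

open scoped InnerProductSpace ComplexConjugate BigOperators Matrix.Norms.L2Operator

namespace Summit.QuantumFields.YangMills.Theorems.Prop7DivRecoveryOfCollectedV2

open Literature.MathematicalPhysics.QuantumFieldTheory.Balaban1983to89
open Literature.MathematicalPhysics.QuantumFieldTheory.Balaban1983to89.T3ContinuumYM3Torus
open T3PrintedRegularMinimiser (RegPr)
open B11Eq103H1Complex (SiteL2K BondL2K)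
open Summit.QuantumFields.YangMills.Theorems.Prop7SectET3Transport (periodsT3)
open Summit.QuantumFields.YangMills.Theorems.Prop7SectET3HilbertLetters (W₂ DL2 DstarL2)
open Summit.QuantumFields.YangMills.Theorems.Prop7SectET3WilsonHessian (DeltaEtaSlot)
open Summit.QuantumFields.YangMills.Theorems.Prop7SectET3CombLetters (Qkc)
open Summit.QuantumFields.YangMills.Theorems.Prop7QprimeCombL2 (RcombL2 RcombL2_isSymmetric RcombL2_idem)
open Summit.QuantumFields.YangMills.Theorems.Prop7DivRecoveryForm (inner_self_of_isSymmetric_idem)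
open Summit.QuantumFields.YangMills.Theorems.Prop7DeltaEtaAlmostPositive (almostPos_DeltaEtaSlot_of_regPr)
open Summit.QuantumFields.YangMills.Theorems.Prop7DivRecoveryAssemblyBudget (rec_shape_of_collected)
open Summit.QuantumFields.YangMills.Theorems.Prop7DivRecoveryOfCover (hRec_of_large)
open Summit.QuantumFields.YangMills.Theorems.Prop7DivRecoveryOfCollected (norm_sq_eq_proj_add_orth)

variable (c₀ cB a₀ : ℕ → ℝ) [hc₀ : ∀ L : ℕ, Fact (0 < c₀ L)] [hcB : ∀ L : ℕ, Fact (0 < cB L)]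

/-- ★★★ **(B7-KNIT) v2 — (REC) VERBATIM FROM THE COLLECTED ROW WITH A FLOOR `s₀`.**  `hColl`: for every `L > 1` a floor `s₀` and an `R`-free `A₃ ≥ 0`, and for every
patch exponent `s ≥ s₀` constants `A₁ A₂ A₄ ≥ 0`,
`eC > 0` such that at every member with `s < F.m + n`, `0 < e ≤ eC`, `RegPr F n K e W`, and every one-form `y`:
`‖D*y − R D*y‖² ≤ A₁·(a₀(c₀∕cB)ℓ³‖Qkc y‖²) + A₂·(re⟪y, Δ^η y⟫ + 1029e‖y‖²) + (A₃·(L^s)⁻² + A₄·e)·‖y‖²`.  Conclusion: the row (REC) of the lane-II door VERBATIM (unchanged from v1: the exponent is chosen as `max s₀ s₁`).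
[cite: Balaban1985BackgroundPropagators, (3.10) p.392, (3.20)-(3.26) pp.394-395, Thm 3.11 p.416] -/
theorem hRec_of_collected_v2 (ha₀ : ∀ L, 1 < L → 0 < a₀ L)
    (hColl : ∀ (L : ℕ), 1 < L → ∃ A₃ : ℝ, 0 ≤ A₃ ∧ ∃ s₀ : ℕ, ∀ s : ℕ, s₀ ≤ s → ∃ A₁ A₂ A₄ eC : ℝ, 0 ≤ A₁ ∧ 0 ≤ A₂ ∧ 0 ≤ A₄ ∧ 0 < eC ∧
      ∀ (F : T3Family), F.L = L → ∀ (n K : ℕ) (hnK : n < K) (e : ℝ) (W : GaugeField (F.P K) 0 (Matrix.specialUnitaryGroup (Fin 2) ℂ)),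
        s < F.m + n → 0 < e → e ≤ eC → RegPr F n K e W →
        ∀ y : BondL2K ℂ 3 (periodsT3 F K) (c₀ F.L) W₂,
          ‖DstarL2 F n K (c₀ F.L) W y - RcombL2 F n K (c₀ F.L) W (DstarL2 F n K (c₀ F.L) W y)‖ ^ 2
            ≤ A₁ * ((a₀ F.L * (c₀ F.L / cB F.L) * ((F.L : ℝ) ^ (K - n)) ^ 3) * ‖Qkc F n K hnK.le (c₀ F.L) (cB F.L) W y‖ ^ 2)
              + A₂ * (RCLike.re ⟪y, DeltaEtaSlot F n K (c₀ F.L) W y⟫_ℂ + 1029 * e * ‖y‖ ^ 2)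
              + (A₃ * ((F.L : ℝ) ^ s)⁻¹ ^ 2 + A₄ * e) * ‖y‖ ^ 2) :
    ∀ (L : ℕ), 1 < L → ∀ δ : ℝ, 0 < δ → ∃ C C' eR : ℝ, 0 ≤ C ∧ 0 ≤ C' ∧ 0 < eR ∧
      ∀ (F : T3Family), F.L = L → ∀ (n K : ℕ) (hnK : n < K) (e : ℝ) (W : GaugeField (F.P K) 0 (Matrix.specialUnitaryGroup (Fin 2) ℂ)),
        0 < e → e ≤ eR → RegPr F n K e W →
        ∀ y : BondL2K ℂ 3 (periodsT3 F K) (c₀ F.L) W₂,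
          ‖DstarL2 F n K (c₀ F.L) W y‖ ^ 2
            ≤ C * (‖RcombL2 F n K (c₀ F.L) W (DstarL2 F n K (c₀ F.L) W y)‖ ^ 2
                  + (a₀ F.L * (c₀ F.L / cB F.L) * ((F.L : ℝ) ^ (K - n)) ^ 3) * ‖Qkc F n K hnK.le (c₀ F.L) (cB F.L) W y‖ ^ 2
                  + RCLike.re ⟪y, DeltaEtaSlot F n K (c₀ F.L) W y⟫_ℂ)
              + (C' * e + δ) * ‖y‖ ^ 2 := by
  refine hRec_of_large c₀ cB a₀ ?_
  intro L hL δ hδ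
  obtain ⟨A₃, hA₃, s₀, hs⟩ := hColl L hL
  -- choose the patch exponent: `A₃·(L^s)⁻² ≤ δ`
  have hL1 : (1 : ℝ) < L := by exact_mod_cast hL
  have hL0 : (0 : ℝ) < L := by linarith
  have hq1 : ((L : ℝ) ^ 2)⁻¹ < 1 := inv_lt_one_of_one_lt₀ (by nlinarith)
  have hq0 : 0 < ((L : ℝ) ^ 2)⁻¹ := by positivity
  obtain ⟨s₁, hsδ₁⟩ := exists_pow_lt_of_lt_one (show 0 < δ / (A₃ + 1) by positivity) hq1
  -- any exponent above BOTH the floor `s₀` and `s₁` serves: the ratio `((L²)⁻¹)^s` is antitone in `s`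
  obtain ⟨s, hs₀s, hsδ⟩ : ∃ s, s₀ ≤ s ∧ (((L : ℝ) ^ 2)⁻¹) ^ s < δ / (A₃ + 1) :=
    ⟨max s₀ s₁, le_max_left _ _, (pow_le_pow_of_le_one hq0.le hq1.le (le_max_right s₀ s₁)).trans_lt hsδ₁⟩
  have hδs : A₃ * ((L : ℝ) ^ s)⁻¹ ^ 2 ≤ δ := by
    have hrew : ((L : ℝ) ^ s)⁻¹ ^ 2 = (((L : ℝ) ^ 2)⁻¹) ^ s := by rw [inv_pow, inv_pow, ← pow_mul, ← pow_mul, mul_comm]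
    rw [hrew]
    have hp0 : 0 ≤ (((L : ℝ) ^ 2)⁻¹) ^ s := pow_nonneg hq0.le s
    have h1 : A₃ * (((L : ℝ) ^ 2)⁻¹) ^ s ≤ (A₃ + 1) * (((L : ℝ) ^ 2)⁻¹) ^ s := mul_le_mul_of_nonneg_right (by linarith) hp0
    have h2 : (A₃ + 1) * (((L : ℝ) ^ 2)⁻¹) ^ s ≤ (A₃ + 1) * (δ / (A₃ + 1)) := mul_le_mul_of_nonneg_left hsδ.le (by linarith)
    have h3 : (A₃ + 1) * (δ / (A₃ + 1)) = δ := by field_simp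
    linarith
  obtain ⟨A₁, A₂, A₄, eC, hA₁, hA₂, hA₄, heC, hrow⟩ := hs s hs₀s
  set C : ℝ := max 1 (max A₁ A₂) with hC
  have hC0 : 0 ≤ C := le_trans zero_le_one (le_max_left _ _)
  refine ⟨C, A₄ + 1029 * C, eC, s, hC0, by positivity, heC, ?_⟩
  intro F hF n K hnK e W hsm he heC' hreg y
  subst hF
  haveI : Fact (0 < c₀ F.L) := hc₀ F.L
  have ha : 0 < a₀ F.L := ha₀ F.L hL
  have hc : 0 < c₀ F.L := (hc₀ F.L).out
  have hb : 0 < cB F.L := (hcB F.L).out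
  -- the reals of Layer A
  have hV := norm_sq_eq_proj_add_orth c₀ F n K W (DstarL2 F n K (c₀ F.L) W y)
  have hG := hrow F rfl n K hnK e W hsm he heC' hreg y
  have hCu := almostPos_DeltaEtaSlot_of_regPr (c₀ := c₀ F.L) he.le W hreg y
  have hAVG : 0 ≤ (a₀ F.L * (c₀ F.L / cB F.L) * ((F.L : ℝ) ^ (K - n)) ^ 3) * ‖Qkc F n K hnK.le (c₀ F.L) (cB F.L) W y‖ ^ 2 := by positivity
  have h := rec_shape_of_collected (V := ‖DstarL2 F n K (c₀ F.L) W y‖ ^ 2)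
    (P := ‖RcombL2 F n K (c₀ F.L) W (DstarL2 F n K (c₀ F.L) W y)‖ ^ 2)
    (G := ‖DstarL2 F n K (c₀ F.L) W y - RcombL2 F n K (c₀ F.L) W (DstarL2 F n K (c₀ F.L) W y)‖ ^ 2)
    (AVG := (a₀ F.L * (c₀ F.L / cB F.L) * ((F.L : ℝ) ^ (K - n)) ^ 3) * ‖Qkc F n K hnK.le (c₀ F.L) (cB F.L) W y‖ ^ 2)
    (Cu := RCLike.re ⟪y, DeltaEtaSlot F n K (c₀ F.L) W y⟫_ℂ) (N := ‖y‖ ^ 2) (e := e) (δ := δ) (R := (F.L : ℝ) ^ s)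
    (A₁ := A₁) (A₂ := A₂) (A₃ := A₃) (A₄ := A₄)
    (sq_nonneg _) hAVG (sq_nonneg _) he.le (by linarith) hV.le hG hδs
  rw [← hC] at h
  exact h

end Summit.QuantumFields.YangMills.Theorems.Prop7DivRecoveryOfCollectedV2

end
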